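import Literature.MathematicalPhysics.QuantumFieldTheory.Balaban1983to89.T4TreeGaugeFixing

/-!
# DAG node N11 — ROOTED PEELING CERTIFICATES: a loop-free bond set with prescribed ROOTS carries a `TreeOrder` whose fresh ends avoid the roots

HEADER — WORK-UNIT METADATA.  Cell `pub-ymgap`, YM-PLAN Track A (HUMAN RULING D-0062), R134 fan-out seat `pub-ymgap-dag-n11-e` (g28) on node N11
[B14]; route `BalabanUVNodes`, key K1⁹ `StabilityBRunRowsAtRecordR13SepCoPHV` = stmt-QuantumFields-27364 (helper, `--kind proof --supports 27364
--as helper`, count-neutral).  Sibling of gen 16's `T4TreeGaugeFixing` (used BY NAME, unmodified: `Joins`, `Touches`, `PathIn`, `pathIn_single`,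
`NoClosedLoop`, `ClosedLoopIn`, `NoClosedLoop.src_ne_tgt`, `TreeOrder.noClosedLoop`) and gen 15's `T4AxialGaugeFixing` (`TreeOrder`).

WHY.  Gen 16 proved FORESTS ⇔ PEELING CERTIFICATES (`NoClosedLoop.exists_treeOrder`): a loop-free bond set `T` carries SOME fresh-endpoint order
`TreeOrder T v r`.  The hard tree gauge UNDER THE δ-FUNCTION of def-T's one-step transport (dag-n11-e g22, `Node00/TransportOfRecordGaugeFixing` §3∕§4:
`kernelTransport_ae_eq_kernelTransport_freeMeasure_glue`, `transportOfRecord_ae_eq_kernelTransport_freeMeasure_glue`) needs MORE: a peeling order whose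
fresh ends `v b` are never block CENTRES `emb y` (the averaging is invariant only under gauge transformations trivial at the centres, [I] p. 254), and the
corner-rooted comb of gen 15 (`treeOrder_combBonds`, fresh end = target) has the centre of the block among its fresh ends.  THIS FILE supplies the
missing combinatorics in general: given a set `R` of ROOTS, a loop-free `T` carries a `TreeOrder` with all fresh ends outside `R` iff no simple path of
positive length in `T` joins two roots (e.g. one root per connected component) — peel LEAVES THAT ARE NOT ROOTS (both ends of a longest simple path are
leaves, and at most one of them is a root).  The companion `…N11TransportBlockCombGauge` instantiates it at the block combs with roots = centres.  (Placed under Summits/ as a new [folklore] result; the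
namespace follows this seat's g21–g23 files.)

WHAT THIS FILE PROVES (10 theorems, 0 `def`, 0 `sorry`, standard axioms; pure finite combinatorics, no group, no measure).
§1 `pathIn_mono` · `pathIn_reverse` (a simple path read backwards is a simple path).
§2 THE POSITIVE LEAF LEMMA: `not_touches_last_of_longest` (the far end of a LONGEST simple path is touched by no bond of `T` other than its last bond —
   gen 16's argument: a second bond there either closes a loop or extends the path) · `not_touches_head_of_longest` (the same at the near end, by reversal).
§3 ★ `exists_pendant_avoiding` (roots `R` joined by no positive path ⇒ a pendant bond whose pendant end is NOT a root).
§4 ★★ `exists_treeOrder_avoiding` (`∃ v r, TreeOrder T v r ∧ ∀ b ∈ T, v b ∉ R` — gen 16's induction, peeling non-root leaves).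
§5 the converse `length_eq_zero_of_treeOrder_avoiding` (fresh ends outside `R` ⇒ no positive path joins two roots: the `m` bonds of such a path would have
   `m` distinct fresh ends among its `m − 1` inner sites) · ★★ `exists_treeOrder_avoiding_iff`.
§6 the LABEL CRITERION used downstream: `length_eq_zero_of_label` (a labelling of sites constant along the bonds of `T` and injective on `R` forbids
   positive paths between roots) · ★★ `exists_treeOrder_avoiding_of_label`.

HONEST FRAMING.  [folklore] finite-graph combinatorics (rooted forests); helper lane of K1⁹, count-neutral; nothing of Bałaban's estimates asserted; (B4) ∕
(O3′) NOT closed; N11 NOT discharged; K1⁹ NOT closed; counts unmoved (typed 28∕28 · discharged 5∕27).  One finite four-torus programme at fixed `ε = L^{−K}`;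
R4 closes only the conditional finite-𝕋⁴ rung `BalabanLadder.UV` — NOT ℝ⁴, NOT OS, NOT a mass gap, NOT Clay.  No `sorry`, `axiom`, `def`, `instance`,
`notation`.
-/

open Function Finset

namespace Summit.QuantumFields.YangMills.Theorems.BalabanUVNodesN11TreeGaugeRooted

open Literature.MathematicalPhysics.QuantumFieldTheory.Balaban1983to89

open T4AxialGaugeFixing (TreeOrder)
open T4TreeGaugeFixing (Joins Touches PathIn pathIn_single NoClosedLoop ClosedLoopIn)

variable {P : Params} {j : ℕ}

/-! ## §1  Simple paths: restriction of the ambient bond set, reversal -/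

/-- A simple path in a sub-bond-set is a simple path in the bond set. [folklore] -/
theorem pathIn_mono {T T' : Finset (PBond P j)} (hTT' : T' ⊆ T) {m : ℕ} {σ : Fin (m + 1) → Site P j} {β : Fin m → PBond P j}
    (h : PathIn T' m σ β) : PathIn T m σ β :=
  ⟨fun i => hTT' (h.mem i), h.joins, h.site_inj⟩

/-- **REVERSAL.**  A simple path read backwards (`σ ∘ rev`, `β ∘ rev`) is a simple path. [folklore] -/
theorem pathIn_reverse {T : Finset (PBond P j)} {m : ℕ} {σ : Fin (m + 1) → Site P j} {β : Fin m → PBond P j}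
    (h : PathIn T m σ β) : PathIn T m (fun t => σ (Fin.rev t)) (fun i => β (Fin.rev i)) where
  mem i := h.mem _
  joins i := by
    show Joins (β (Fin.rev i)) (σ (Fin.rev i.castSucc)) (σ (Fin.rev i.succ))
    rw [Fin.rev_castSucc, Fin.rev_succ]
    exact (h.joins _).symm
  site_inj := h.site_inj.comp Fin.rev_injective

/-! ## §2  The positive leaf lemma: both ends of a longest simple path are pendant -/

/-- **THE FAR END OF A LONGEST SIMPLE PATH IS PENDANT** (gen 16's leaf lemma in positive form): if `σ 0, …, σ M` (`M ≥ 1`) is a simple path of `T` of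
maximal length, no bond of `T` other than its last bond `β (M − 1)` touches `σ M` — a second bond there would either return to the path (a closed loop)
or leave it (a longer simple path). [folklore] -/
theorem not_touches_last_of_longest {T : Finset (PBond P j)} (hT : NoClosedLoop T) {M : ℕ} {σ : Fin (M + 1) → Site P j}
    {β : Fin M → PBond P j} (hp : PathIn T M σ β) (h1M : 1 ≤ M)
    (hmax : ∀ (m : ℕ) (σ' : Fin (m + 1) → Site P j) (β' : Fin m → PBond P j), PathIn T m σ' β' → m ≤ M)
    {b' : PBond P j} (hb'T : b' ∈ T) (hb'ne : b' ≠ β ⟨M - 1, by omega⟩) : ¬ Touches b' (σ (Fin.last M)) := by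
  classical
  intro hb'e
  set iL : Fin M := ⟨M - 1, by omega⟩ with hiLdef
  have hiL : iL.succ = Fin.last M := Fin.ext (by simp [iL]; omega)
  -- the other end `y ≠ σ M` of `b'`
  obtain ⟨y, hy, hye⟩ : ∃ y, Joins b' (σ (Fin.last M)) y ∧ y ≠ σ (Fin.last M) := by
    rcases hb'e with h | h
    · exact ⟨b'.tgt, Or.inl ⟨h, rfl⟩, fun h' => hT.src_ne_tgt hb'T (h.trans h'.symm)⟩
    · exact ⟨b'.src, Or.inr ⟨rfl, h⟩, fun h' => hT.src_ne_tgt hb'T (h'.trans h.symm)⟩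
  by_cases hyσ : y ∈ Set.range σ
  · -- `y = σ i₀` is on the path: `σ i₀, …, σ M` with the bonds `β i₀, …, β (M-1), b'` is a closed loop
    obtain ⟨i₀, rfl⟩ := hyσ
    have hi₀M : (i₀ : ℕ) ≠ M := fun h => hye (congrArg σ (Fin.ext (by simpa using h)))
    have hi₀ : (i₀ : ℕ) < M := by have := i₀.isLt; omega
    set k := M - i₀ with hk
    let σ' : Fin (k + 1) → Site P j := fun t => σ ⟨i₀ + t, by omega⟩
    let β' : Fin (k + 1) → PBond P j := fun t => if h : (t : ℕ) < k then β ⟨i₀ + t, by omega⟩ else b'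
    -- the bond `β ⟨i₀ + t, _⟩`, `t < k`, is not `b'`: `b'` touches `σ M`, which is an end of `β i` only for `i = M - 1`
    have hβne : ∀ (t : ℕ) (ht : i₀ + t < M), β ⟨i₀ + t, ht⟩ ≠ b' := by
      intro t ht heq
      have hj := hp.joins ⟨i₀ + t, ht⟩
      rw [heq] at hj
      rcases hj.eq_or_eq_of_touches hb'e with h' | h'
      · have := congrArg Fin.val (hp.site_inj h'); simp at this; omega
      · have hval := congrArg Fin.val (hp.site_inj h')
        simp only [Fin.val_last, Fin.val_succ] at hval
        have : (⟨i₀ + t, ht⟩ : Fin M) = iL := Fin.ext (by simp [iL]; omega)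
        exact hb'ne (heq.symm.trans (congrArg β this))
    refine hT k σ' β' ⟨?_, ?_, ?_, ?_⟩
    · intro t
      by_cases ht : (t : ℕ) < k
      · simp only [β', dif_pos ht]; exact hp.mem _
      · simp only [β', dif_neg ht]; exact hb'T
    · intro t
      by_cases ht : (t : ℕ) < k
      · have ht1 : ((t + 1 : Fin (k + 1)) : ℕ) = t + 1 :=
          Fin.val_add_one_of_lt (Fin.lt_def.2 (by simpa using ht))
        have e2 : σ' (t + 1) = σ (⟨i₀ + t, by omega⟩ : Fin M).succ := by
          simp only [σ']; congr 1; exact Fin.ext (by simp only [Fin.val_succ, ht1]; omega)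
        simp only [β', dif_pos ht]
        rw [e2]
        exact hp.joins _
      · have htk : (t : ℕ) = k := by have := t.isLt; omega
        have htl : t = Fin.last k := Fin.ext (by simpa using htk)
        have e1 : σ' t = σ (Fin.last M) := by
          simp only [σ']; congr 1; exact Fin.ext (by simp only [Fin.val_last]; omega)
        have e2 : σ' (t + 1) = σ i₀ := by
          rw [htl, Fin.last_add_one]; simp only [σ']; congr 1
        simp only [β', dif_neg ht]
        rw [e1, e2]
        exact hy
    · intro t t' htt'
      have := congrArg Fin.val (hp.site_inj htt')
      simp only at this
      exact Fin.ext (by omega)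
    · intro t t' htt'
      by_cases ht : (t : ℕ) < k <;> by_cases ht' : (t' : ℕ) < k
      · simp only [β', dif_pos ht, dif_pos ht'] at htt'
        have := congrArg Fin.val (hp.bond_injective htt')
        simp only at this
        exact Fin.ext (by omega)
      · simp only [β', dif_pos ht, dif_neg ht'] at htt'
        exact absurd htt' (hβne t (by omega))
      · simp only [β', dif_neg ht, dif_pos ht'] at htt'
        exact absurd htt'.symm (hβne t' (by omega))
      · have h1 := t.isLt; have h2 := t'.isLt
        exact Fin.ext (by omega)
  · -- `y` is new: the path extends by `b'`, contradicting maximality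
    have hp' : PathIn T (M + 1) (Fin.snoc σ y) (Fin.snoc β b') := by
      refine ⟨?_, ?_, Fin.snoc_injective_iff.2 ⟨hp.site_inj, hyσ⟩⟩
      · intro i
        rcases i.eq_castSucc_or_eq_last with ⟨i, rfl⟩ | rfl
        · rw [Fin.snoc_castSucc]; exact hp.mem i
        · rw [Fin.snoc_last]; exact hb'T
      · intro i
        rcases i.eq_castSucc_or_eq_last with ⟨i, rfl⟩ | rfl
        · rw [Fin.snoc_castSucc, Fin.snoc_castSucc, Fin.succ_castSucc, Fin.snoc_castSucc]; exact hp.joins i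
        · rw [Fin.snoc_last, Fin.snoc_castSucc, Fin.succ_last, Fin.snoc_last]; exact hy
    have := hmax (M + 1) _ _ hp'
    omega

/-- **THE NEAR END OF A LONGEST SIMPLE PATH IS PENDANT**: no bond of `T` other than its first bond `β 0` touches `σ 0` (the far-end statement for the
reversed path). [folklore] -/
theorem not_touches_head_of_longest {T : Finset (PBond P j)} (hT : NoClosedLoop T) {M : ℕ} {σ : Fin (M + 1) → Site P j}
    {β : Fin M → PBond P j} (hp : PathIn T M σ β) (h1M : 1 ≤ M)
    (hmax : ∀ (m : ℕ) (σ' : Fin (m + 1) → Site P j) (β' : Fin m → PBond P j), PathIn T m σ' β' → m ≤ M)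
    {b' : PBond P j} (hb'T : b' ∈ T) (hb'ne : b' ≠ β ⟨0, by omega⟩) : ¬ Touches b' (σ 0) := by
  have hrev : (Fin.rev (⟨M - 1, by omega⟩ : Fin M)) = ⟨0, by omega⟩ := Fin.ext (by simp [Fin.val_rev]; omega)
  have key := not_touches_last_of_longest hT (pathIn_reverse hp) h1M hmax hb'T (by rw [hrev]; exact hb'ne)
  simpa only [Fin.rev_last] using key

/-! ## §3  A pendant bond whose pendant end is not a root -/

/-- ★ **A NON-ROOT LEAF.**  Let `R` be a set of ROOTS such that no simple path of positive length in the loop-free bond set `T` joins two roots (e.g. at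
most one root per connected component).  If `T` is nonempty it has a pendant bond `b` with pendant end `x ∉ R` (touched by no other bond of `T`): the two
ends of a longest simple path are pendant (§2) and distinct, and they are joined by that path, so at most one of them is a root. [folklore] -/
theorem exists_pendant_avoiding {T : Finset (PBond P j)} (hT : NoClosedLoop T) (hne : T.Nonempty) (R : Set (Site P j))
    (hR : ∀ (m : ℕ) (σ : Fin (m + 1) → Site P j) (β : Fin m → PBond P j), PathIn T m σ β →
      σ 0 ∈ R → σ (Fin.last m) ∈ R → m = 0) :
    ∃ b ∈ T, ∃ x, x ∉ R ∧ Touches b x ∧ ∀ b' ∈ T, b' ≠ b → ¬ Touches b' x := by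
  classical
  obtain ⟨b₁, hb₁⟩ := hne
  -- a longest simple path (lengths are `< #sites`)
  let Q : ℕ → Prop := fun m => ∃ (σ : Fin (m + 1) → Site P j) (β : Fin m → PBond P j), PathIn T m σ β
  have hQ1 : Q 1 := ⟨_, _, pathIn_single hb₁ (hT.src_ne_tgt hb₁)⟩
  set N := Fintype.card (Site P j) with hN
  have h1N : 1 ≤ N := by have := (pathIn_single hb₁ (hT.src_ne_tgt hb₁)).succ_length_le_card; omega
  have hmax : ∀ m, Q m → m ≤ Nat.findGreatest Q N := fun m ⟨σ, β, hp⟩ =>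
    Nat.le_findGreatest (by have := hp.succ_length_le_card; omega) ⟨σ, β, hp⟩
  set M := Nat.findGreatest Q N with hM
  obtain ⟨σ, β, hp⟩ : Q M := Nat.findGreatest_spec h1N hQ1
  have h1M : 1 ≤ M := Nat.le_findGreatest h1N hQ1
  have hmax' : ∀ (m : ℕ) (σ' : Fin (m + 1) → Site P j) (β' : Fin m → PBond P j), PathIn T m σ' β' → m ≤ M :=
    fun m σ' β' hp' => hmax m ⟨σ', β', hp'⟩
  by_cases hL : σ (Fin.last M) ∈ R
  · by_cases h0 : σ 0 ∈ R
    · exact absurd (hR M σ β hp h0 hL) (by omega)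
    · refine ⟨β ⟨0, by omega⟩, hp.mem _, σ 0, h0, ?_,
        fun b' hb' hne => not_touches_head_of_longest hT hp h1M hmax' hb' hne⟩
      have e0 : (Fin.castSucc (⟨0, by omega⟩ : Fin M)) = (0 : Fin (M + 1)) := Fin.ext (by simp)
      have h := (hp.joins ⟨0, by omega⟩).touches_left
      rwa [e0] at h
  · refine ⟨β ⟨M - 1, by omega⟩, hp.mem _, σ (Fin.last M), hL, ?_,
      fun b' hb' hne => not_touches_last_of_longest hT hp h1M hmax' hb' hne⟩
    have hiL : (⟨M - 1, by omega⟩ : Fin M).succ = Fin.last M := Fin.ext (by simp; omega)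
    have h := (hp.joins ⟨M - 1, by omega⟩).touches_right
    rwa [hiL] at h

/-! ## §4  Rooted peeling certificates -/

/-- ★★ **ROOTED FORESTS CARRY ROOT-AVOIDING PEELING CERTIFICATES.**  A loop-free bond set `T` with a root set `R` joined by no simple path of positive length
in `T` admits a `TreeOrder` WHOSE FRESH ENDS AVOID `R`: peel a non-root leaf (§3), order the rest by induction, give the pendant end a rank above both ends of
its bond (gen 16's step verbatim). [folklore] -/
theorem exists_treeOrder_avoiding {T : Finset (PBond P j)} (hT : NoClosedLoop T) (R : Set (Site P j))
    (hR : ∀ (m : ℕ) (σ : Fin (m + 1) → Site P j) (β : Fin m → PBond P j), PathIn T m σ β →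
      σ 0 ∈ R → σ (Fin.last m) ∈ R → m = 0) :
    ∃ (v : PBond P j → Site P j) (r : Site P j → ℕ), TreeOrder T v r ∧ ∀ b ∈ T, v b ∉ R := by
  classical
  suffices H : ∀ (n : ℕ) (T : Finset (PBond P j)), T.card = n → NoClosedLoop T →
      (∀ (m : ℕ) (σ : Fin (m + 1) → Site P j) (β : Fin m → PBond P j), PathIn T m σ β →
        σ 0 ∈ R → σ (Fin.last m) ∈ R → m = 0) →
      ∃ (v : PBond P j → Site P j) (r : Site P j → ℕ), TreeOrder T v r ∧ ∀ b ∈ T, v b ∉ R from H _ T rfl hT hR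
  intro n
  induction n with
  | zero =>
    intro T hc _ _
    rw [Finset.card_eq_zero] at hc
    subst hc
    exact ⟨fun b => b.src, fun _ => 0, ⟨by simp, by simp, by simp, by simp⟩, by simp⟩
  | succ n ih =>
    intro T hc hT hR
    have hne : T.Nonempty := by rw [← Finset.card_pos, hc]; exact Nat.succ_pos n
    obtain ⟨b, hb, x, hxR, hbx, hpend⟩ := exists_pendant_avoiding hT hne R hR
    obtain ⟨v, r, hvr, hvR⟩ := ih (T.erase b) (by rw [Finset.card_erase_of_mem hb, hc]; rfl)
      (hT.mono (Finset.erase_subset b T))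
      (fun m σ β hp => hR m σ β (pathIn_mono (Finset.erase_subset b T) hp))
    have hpend' : ∀ c ∈ T, c ≠ b → c.src ≠ x ∧ c.tgt ≠ x := fun c hc hcb => not_or.1 (hpend c hc hcb)
    refine ⟨update v b x, update r x (max (r b.src) (r b.tgt) + 1), ⟨?_, fun c hc => hT.src_ne_tgt hc, ?_, ?_⟩, ?_⟩
    · -- endpoint
      intro c hc
      by_cases hcb : c = b
      · subst hcb; rw [update_self]
        rcases hbx with h | h
        · exact Or.inl h.symm
        · exact Or.inr h.symm
      · rw [update_of_ne hcb]; exact hvr.endpoint c (Finset.mem_erase.2 ⟨hcb, hc⟩)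
    · -- injectivity of the fresh ends: no other bond touches `x`
      intro c hc c' hc' hcc'
      by_cases hcb : c = b <;> by_cases hc'b : c' = b
      · exact hcb.trans hc'b.symm
      · exfalso
        rw [hcb, update_self, update_of_ne hc'b] at hcc'
        rcases hvr.endpoint c' (Finset.mem_erase.2 ⟨hc'b, hc'⟩) with h | h
        · exact (hpend' c' hc' hc'b).1 (h ▸ hcc'.symm)
        · exact (hpend' c' hc' hc'b).2 (h ▸ hcc'.symm)
      · exfalso
        rw [hc'b, update_self, update_of_ne hcb] at hcc'
        rcases hvr.endpoint c (Finset.mem_erase.2 ⟨hcb, hc⟩) with h | h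
        · exact (hpend' c hc hcb).1 (h ▸ hcc')
        · exact (hpend' c hc hcb).2 (h ▸ hcc')
      · rw [update_of_ne hcb, update_of_ne hc'b] at hcc'
        exact hvr.inj c (Finset.mem_erase.2 ⟨hcb, hc⟩) c' (Finset.mem_erase.2 ⟨hc'b, hc'⟩) hcc'
    · -- rank
      intro c hc
      by_cases hcb : c = b
      · subst hcb
        rw [update_self]
        have hst := hT.src_ne_tgt hc
        rcases hbx with h | h
        · right
          have htx : c.tgt ≠ x := fun h' => hst (h.trans h'.symm)
          rw [update_of_ne htx, update_self]
          exact Nat.lt_succ_of_le (le_max_right _ _)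
        · left
          have hsx : c.src ≠ x := fun h' => hst (h'.trans h.symm)
          rw [update_of_ne hsx, update_self]
          exact Nat.lt_succ_of_le (le_max_left _ _)
      · obtain ⟨hsx, htx⟩ := hpend' c hc hcb
        have hvx : v c ≠ x := by
          rcases hvr.endpoint c (Finset.mem_erase.2 ⟨hcb, hc⟩) with h | h
          · rw [h]; exact hsx
          · rw [h]; exact htx
        rw [update_of_ne hcb, update_of_ne hsx, update_of_ne htx, update_of_ne hvx]
        exact hvr.rank c (Finset.mem_erase.2 ⟨hcb, hc⟩)
    · -- the fresh ends avoid the roots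
      intro c hc
      by_cases hcb : c = b
      · subst hcb; rw [update_self]; exact hxR
      · rw [update_of_ne hcb]; exact hvR c (Finset.mem_erase.2 ⟨hcb, hc⟩)

/-! ## §5  The converse: root-avoiding fresh ends forbid positive paths between roots -/

/-- **THE CONVERSE.**  If `T` carries a `TreeOrder` whose fresh ends avoid `R`, no simple path of positive length in `T` joins two roots: the `m` bonds of
such a path have `m` pairwise distinct fresh ends among its sites `σ 0, …, σ m`, none of them a root, so among the `m − 1` inner sites — impossible.
[folklore] -/
theorem length_eq_zero_of_treeOrder_avoiding {T : Finset (PBond P j)} {v : PBond P j → Site P j} {r : Site P j → ℕ}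
    (hT : TreeOrder T v r) {R : Set (Site P j)} (hv : ∀ b ∈ T, v b ∉ R) {m : ℕ} {σ : Fin (m + 1) → Site P j}
    {β : Fin m → PBond P j} (hp : PathIn T m σ β) (h0 : σ 0 ∈ R) (hl : σ (Fin.last m) ∈ R) : m = 0 := by
  classical
  by_contra hm
  -- the index of the fresh end of `β i` among the sites of the path
  have hf : ∀ i : Fin m, ∃ t : Fin (m + 1), v (β i) = σ t := by
    intro i
    rcases hT.endpoint (β i) (hp.mem i) with h | h
    · rcases hp.joins i with ⟨h1, -⟩ | ⟨h1, -⟩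
      · exact ⟨i.castSucc, h.trans h1⟩
      · exact ⟨i.succ, h.trans h1⟩
    · rcases hp.joins i with ⟨-, h1⟩ | ⟨-, h1⟩
      · exact ⟨i.succ, h.trans h1⟩
      · exact ⟨i.castSucc, h.trans h1⟩
  choose f hvf using hf
  have hfinj : Function.Injective f := by
    intro i i' h
    have hvv : v (β i) = v (β i') := by rw [hvf, hvf, h]
    exact hp.bond_injective (hT.inj _ (hp.mem i) _ (hp.mem i') hvv)
  have hf0 : ∀ i, f i ≠ 0 := fun i h => hv _ (hp.mem i) (by rw [hvf, h]; exact h0)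
  have hfl : ∀ i, f i ≠ Fin.last m := fun i h => hv _ (hp.mem i) (by rw [hvf, h]; exact hl)
  have hl0 : Fin.last m ≠ (0 : Fin (m + 1)) := by
    intro h; apply hm; have := congrArg Fin.val h; simpa using this
  have hsub : Finset.univ.image f ⊆ ((Finset.univ : Finset (Fin (m + 1))).erase 0).erase (Fin.last m) := by
    intro t ht
    obtain ⟨i, -, rfl⟩ := Finset.mem_image.1 ht
    exact Finset.mem_erase.2 ⟨hfl i, Finset.mem_erase.2 ⟨hf0 i, Finset.mem_univ _⟩⟩
  have hcard := Finset.card_le_card hsub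
  rw [Finset.card_image_of_injective _ hfinj, Finset.card_univ, Fintype.card_fin,
    Finset.card_erase_of_mem (Finset.mem_erase.2 ⟨hl0, Finset.mem_univ _⟩),
    Finset.card_erase_of_mem (Finset.mem_univ _), Finset.card_univ, Fintype.card_fin] at hcard
  omega

/-- ★★ **ROOTED FORESTS ⇔ ROOT-AVOIDING PEELING CERTIFICATES.**  `T` carries a `TreeOrder` whose fresh ends avoid `R` iff `T` is loop-free and no simple path
of positive length in `T` joins two points of `R`. [folklore] -/
theorem exists_treeOrder_avoiding_iff (T : Finset (PBond P j)) (R : Set (Site P j)) :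
    (∃ (v : PBond P j → Site P j) (r : Site P j → ℕ), TreeOrder T v r ∧ ∀ b ∈ T, v b ∉ R) ↔
      NoClosedLoop T ∧ ∀ (m : ℕ) (σ : Fin (m + 1) → Site P j) (β : Fin m → PBond P j), PathIn T m σ β →
        σ 0 ∈ R → σ (Fin.last m) ∈ R → m = 0 :=
  ⟨fun ⟨_, _, h, hv⟩ => ⟨h.noClosedLoop, fun _ _ _ hp h0 hl => length_eq_zero_of_treeOrder_avoiding h hv hp h0 hl⟩,
    fun ⟨h, hR⟩ => exists_treeOrder_avoiding h R hR⟩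

/-! ## §6  The label criterion: a labelling constant along `T` and injective on the roots -/

/-- **THE LABEL CRITERION.**  If a labelling `ℓ` of the sites is constant along every bond of `T` (e.g. the block label `blockOf` along within-block bonds)
and injective on `R` (e.g. one centre per block), then no simple path of positive length in `T` joins two roots: `ℓ` is constant along the path, so its two
ends are the same root, contradicting simplicity. [folklore] -/
theorem length_eq_zero_of_label {T : Finset (PBond P j)} {α : Type*} (ℓ : Site P j → α) (hℓ : ∀ b ∈ T, ℓ b.src = ℓ b.tgt)
    {R : Set (Site P j)} (hinj : ∀ x ∈ R, ∀ x' ∈ R, ℓ x = ℓ x' → x = x') {m : ℕ} {σ : Fin (m + 1) → Site P j}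
    {β : Fin m → PBond P j} (hp : PathIn T m σ β) (h0 : σ 0 ∈ R) (hl : σ (Fin.last m) ∈ R) : m = 0 := by
  have hconst : ∀ i : Fin (m + 1), ℓ (σ i) = ℓ (σ 0) := by
    intro i
    induction i using Fin.induction with
    | zero => rfl
    | succ i ih =>
      rw [← ih]
      rcases hp.joins i with ⟨h1, h2⟩ | ⟨h1, h2⟩
      · rw [← h1, ← h2]; exact (hℓ _ (hp.mem i)).symm
      · rw [← h1, ← h2]; exact hℓ _ (hp.mem i)
  have h := hp.site_inj (hinj _ hl _ h0 (hconst (Fin.last m)))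
  have := congrArg Fin.val h
  simpa using this

/-- ★★ **ROOT-AVOIDING PEELING CERTIFICATES FROM A LABELLING**: a loop-free `T` whose bonds never change the label `ℓ` carries, for every root set `R` on which
`ℓ` is injective, a `TreeOrder` whose fresh ends avoid `R`. [folklore] -/
theorem exists_treeOrder_avoiding_of_label {T : Finset (PBond P j)} (hT : NoClosedLoop T) {α : Type*} (ℓ : Site P j → α)
    (hℓ : ∀ b ∈ T, ℓ b.src = ℓ b.tgt) (R : Set (Site P j)) (hinj : ∀ x ∈ R, ∀ x' ∈ R, ℓ x = ℓ x' → x = x') :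
    ∃ (v : PBond P j → Site P j) (r : Site P j → ℕ), TreeOrder T v r ∧ ∀ b ∈ T, v b ∉ R :=
  exists_treeOrder_avoiding hT R fun _ _ _ hp h0 hl => length_eq_zero_of_label ℓ hℓ hinj hp h0 hl

end Summit.QuantumFields.YangMills.Theorems.BalabanUVNodesN11TreeGaugeRooted
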